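import Summits.Langlands.Langlands.Theorems.ParityBlindBianchiQuadraticDescentGL2TwistedAsaiPoleCont
import HarnessLib

/-!
# Stub `stub_twistedAsaiPoleCont` of line `Sketch` — the twisted Asai pole from Galois-stability,
# continuation currency, one datum (crux `ParityBlindBianchi.QuadraticDescentGL2`, stmt-Langlands-16811)

Lead prover, 2026-08-17, skeleton v2. The registered stub `stub_twistedAsaiPoleCont`: for `E/F` Galois
quadratic with involution `c ≠ 1`, a cuspidal `P` on `GL₂(𝔸_E)` with `Gal(E/F)`-stable Satake data a.e., a
Hecke character `χ` of `F` with `ω_P = χ⁻¹ ∘ N` on Satake data a.e., and GIVEN the continuations of the two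
twisted partial Asai `L`-functions of `(P, χ)` at every Asai datum on which the central relation holds
pointwise (the statement of Flicker 1988, Theorem p. 297 with p. 296, specialised to `F, E, c, P, χ` — the
registered fact-stub `stub_factFlickerContinuation` / Literature named fact
`Flicker1988_twistedAsaiL_continuation_GL2`), SOME sign `η` and SOME Asai datum `(S, A) ⊇ ram χ` carry a
continued simple pole: `(s - 1) L^S(s, P, As^η ⊗ χ)` continues holomorphically to `{1 < Re s} ∪ B(1, δ)` and
is `≠ 0` at `s = 1`.

Proof: the wave-1 helpers of this line — `exists_finite_offLarge_hyps` (the a.e. hypotheses hold pointwise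
off a large `S`), `exists_finite_twistedAsai_dichotomy` (factorisation `L^{S_E}(s, P × P^∨) =
L^S(As⁺ ⊗ χ) L^S(As⁻ ⊗ χ)`, the Jacquet–Shalika simple pole of the left side on `GL₂` from theorems, and the
order count at `s = 1`), both in `…TwistedAsaiPoleCont` / `…TwistedAsaiPoleDichotomy` /
`…AsaiFactorisation` — applied at one large Asai datum (`AutomorphicRepData.exists_isAsaiDatum`,
`IsAsaiDatum.mono`, `HeckeCharacter.finite_ramifiedPlaces_holds`), where the continuation hypothesis is
available because the central relation holds pointwise there.
-/

set_option linter.dupNamespace false -- `Summit.Langlands.Langlands` is the mandated namespace (lakefile weak option)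

noncomputable section

open scoped Classical Topology
open Filter Polynomial NumberField IsDedekindDomain
open Literature.NumberTheory.Automorphic Literature.NumberTheory.GaloisRepresentations

namespace Summit.Langlands.Langlands.Theorems.QuadraticDescentGL2.Sketch

/-- **Registered stub `stub_twistedAsaiPoleCont` (line `Sketch`, crux stmt-Langlands-16811).** For `E/F`
Galois quadratic with involution `c ≠ 1`, a cuspidal `P` on `GL₂(𝔸_E)` with `Gal(E/F)`-stable Satake data
a.e. and `ω_P = χ⁻¹ ∘ N_{E/F}` on Satake data a.e., granted the continuations of
`(s - 1) L^S(s, P, As^θ ⊗ χ)` (`θ = ±1`) to `{1 < Re s} ∪ B(1, δ)` at every Asai datum of `P` on which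
`e₂(t_{P,w}) χ(ϖ_v)^{f(w|v)} = 1` pointwise (Flicker 1988): some sign `η` and Asai datum `(S, A) ⊇ ram χ`
at which the continued `(s - 1) L^S(s, P, As^η ⊗ χ)` is non-zero at `s = 1`.
[cite: Flicker1988, Theorem p. 297 and p. 296] [cite: ArthurClozelAMS120, Ch. 3 §2 (2.3)] -/
theorem stub_twistedAsaiPoleCont :
    ∀ (F E : Type) [Field F] [NumberField F] [Field E] [NumberField E] [Algebra F E] [IsGalois F E]
      (c : E ≃ₐ[F] E), Module.finrank F E = 2 → c ≠ 1 →
      ∀ (hE : isCompact_glFiniteIntegralLevel 2 E) (P : CuspidalAutomorphicRepData 2 E hE)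
        (χ : HeckeCharacter F),
        IsGaloisStableSatakeAE F P.1 →
        (∀ᶠ w : HeightOneSpectrum (𝓞 E) in cofinite, ∀ α : Multiset ℂ,
            P.1.HasSatakeParamAt w α → χ.IsUnramifiedAt (w.under (𝓞 F)) →
              α.prod * χ.valueAtUniformizer (w.under (𝓞 F)) ^ w.asIdeal.inertiaDeg (𝓞 F) = 1) →
        (∀ (S : Set (HeightOneSpectrum (𝓞 F))) (A : SatakeFamily E),
          P.1.IsAsaiDatum c S A → χ.ramifiedPlaces ⊆ S →
          (∀ w : HeightOneSpectrum (𝓞 E), w.under (𝓞 F) ∉ S →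
            (A w).prod * χ.valueAtUniformizer (w.under (𝓞 F)) ^ w.asIdeal.inertiaDeg (𝓞 F) = 1) →
          ∃ σ₀ : ℝ, 1 ≤ σ₀ ∧
            (∀ (θ : ℤˣ) (s : ℂ), σ₀ < s.re →
              Multipliable fun v : {v : HeightOneSpectrum (𝓞 F) // v ∉ S} =>
                ((asaiLocalPolynomial c A θ (placeAbove E v.1)).eval
                  (χ.valueAtUniformizer v.1 * (v.1.residueCard : ℂ) ^ (-s)))⁻¹) ∧
            ∃ δ : ℝ, 0 < δ ∧ ∀ θ : ℤˣ, ∃ G : ℂ → ℂ,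
              DifferentiableOn ℂ G ({s : ℂ | 1 < s.re} ∪ Metric.ball (1 : ℂ) δ) ∧
              ∀ s : ℂ, σ₀ < s.re →
                G s = (s - 1) * partialAsaiLTwist S c A (fun v => χ.valueAtUniformizer v) θ s) →
        ∃ (η : ℤˣ) (S : Set (HeightOneSpectrum (𝓞 F))) (A : SatakeFamily E),
          P.1.IsAsaiDatum c S A ∧ χ.ramifiedPlaces ⊆ S ∧
          ∃ σ₀ : ℝ, 1 ≤ σ₀ ∧
            (∀ s : ℂ, σ₀ < s.re →
              Multipliable fun v : {v : HeightOneSpectrum (𝓞 F) // v ∉ S} =>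
                ((asaiLocalPolynomial c A η (placeAbove E v.1)).eval
                  (χ.valueAtUniformizer v.1 * (v.1.residueCard : ℂ) ^ (-s)))⁻¹) ∧
            ∃ (δ : ℝ) (G : ℂ → ℂ), 0 < δ ∧
              DifferentiableOn ℂ G ({s : ℂ | 1 < s.re} ∪ Metric.ball (1 : ℂ) δ) ∧
              (∀ s : ℂ, σ₀ < s.re →
                G s = (s - 1) * partialAsaiLTwist S c A (fun v => χ.valueAtUniformizer v) η s) ∧
              G 1 ≠ 0 := by
  intro F E _ _ _ _ _ _ c h2 hc hE P χ hst hχ hHol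
  classical
  -- the dichotomy at every large datum, and the pointwise hypotheses off a large `S`
  obtain ⟨S₀, hS₀fin, hdich⟩ := exists_finite_twistedAsai_dichotomy h2 hc P χ hst hχ
  obtain ⟨S₁, hS₁fin, hpt⟩ := exists_finite_offLarge_hyps c P.1 χ hst hχ
  -- a large Asai datum
  obtain ⟨S', A, hSA'⟩ := AutomorphicRepData.exists_isAsaiDatum h2 hc P.1
  have hram : χ.ramifiedPlaces.Finite := χ.finite_ramifiedPlaces_holds
  set S : Set (HeightOneSpectrum (𝓞 F)) := S' ∪ ((S₀ ∪ S₁) ∪ χ.ramifiedPlaces) with hS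
  have hSA : P.1.IsAsaiDatum c S A :=
    hSA'.mono Set.subset_union_left (hSA'.finite.union ((hS₀fin.union hS₁fin).union hram))
  have hχS : χ.ramifiedPlaces ⊆ S := Set.subset_union_right.trans Set.subset_union_right
  have hS₀S : S₀ ⊆ S :=
    (Set.subset_union_left.trans Set.subset_union_left).trans Set.subset_union_right
  have hS₁S : S₁ ⊆ S :=
    (Set.subset_union_right.trans Set.subset_union_left).trans Set.subset_union_right
  -- the central relation holds pointwise on this datum
  have hcent : ∀ w : HeightOneSpectrum (𝓞 E), w.under (𝓞 F) ∉ S →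
      (A w).prod * χ.valueAtUniformizer (w.under (𝓞 F)) ^ w.asIdeal.inertiaDeg (𝓞 F) = 1 :=
    fun w hw => (hpt hχS hS₁S w hw).2 _ (hSA.hasSatakeParamAt hw)
  -- the continuations at this datum, and the dichotomy
  obtain ⟨σ₀, hσ₀, hmul, δ, hδ, hG⟩ := hHol S A hSA hχS hcent
  choose G hGhol hGL using hG
  obtain ⟨η, hη, -, -⟩ := hdich hSA hχS hS₀S hσ₀ hδ hmul hGhol hGL
  exact ⟨η, S, A, hSA, hχS, σ₀, hσ₀, hmul η, δ, G η, hδ, hGhol η, hGL η, hη⟩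

end Summit.Langlands.Langlands.Theorems.QuadraticDescentGL2.Sketch

end
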